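import Summits.CriticalPhenomena.PercolationContinuityZ3.Theorems.SahiCISPositivity
import Summits.CriticalPhenomena.PercolationContinuityZ3.Theorems.SahiCISNonClosureLaws

/-!
# CIS in the a.e.-kernel sense agrees with classical CIS on the support, for finitely supported laws

Cell `prim-sahi`, typer (generation 17); `--supports stmt-CriticalPhenomena-4575`.  No named facts, no sorries.

For a law `μ` on `Q_{d+1}` let `ρ =` law of `((x_0,…,x_{d−1}), x_d)` and `ν = ρ.fst`.  The classical (textbook)
CIS condition for the last coordinate, written WITHOUT conditional distributions so that it makes sense for every
law, is the cross-multiplied atom condition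
  `ρ({b} × [0,x]) · ν{a} ≤ ρ({a} × [0,x]) · ν{b}`   for all conditioning points `a ≤ b` and all `x`
(`IsCISatom`, recursively at every level) — for atoms `a, b` of `ν` it says `P(X_d ≤ x | X' = b) ≤ P(X_d ≤ x | X' = a)`,
and it is void when `ν{a} ν{b} = 0`.

* **`IsCISae.isCISatom`** — every `IsCISae` law satisfies it (atom pairs of positive mass are atoms of `ν ⊗ ν`, and a
  disintegration kernel is pinned at atoms: `kernel_apply_mul_singleton`).
* **`isCISae_of_isCISatom_of_finite_support`** — conversely, for FINITELY SUPPORTED laws the atom condition gives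
  `IsCISae`: the conditional laws at the atoms, extended by `δ_0` elsewhere, form a Markov kernel (`atomKernel`)
  disintegrating `ρ` (`fst_compProd_atomKernel`) that is stochastically increasing on almost every pair.  Hence
  **`isCISae_iff_isCISatom_of_finite_support`**: on finitely supported laws, the a.e.-kernel notion IS classical CIS.
* Consequences for every finitely supported classically-CIS law on `Q_d` — e.g. any CIS law on a finite grid
  `{0,…,m}^d ⊂ [0,1]^d`: monotone coupling to Lebesgue measure, positive association, Sahi positivity given
  `L(d,n)`, and UNCONDITIONALLY `E₃ ≥ 0` on `[0,1]³` (`msahiE_three_nonneg_of_isCISatom`).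

References: Müller–Stoyan 2002, Def. 3.10.9 (CIS), Thm. 3.10.11 [MullerStoyan2002].  Statements are this work.
-/

noncomputable section

namespace Summit.CriticalPhenomena.PercolationContinuityZ3.Theorems.SahiCIS

open MeasureTheory ProbabilityTheory Set Filter Topology Function
open Summit.CriticalPhenomena.PercolationContinuityZ3.Theorems.SahiBoxTP2
open Literature.Combinatorics.Sahi2008
open scoped ENNReal unitInterval

/-! ### Generic facts -/

section Generic

variable {α β : Type*} [MeasurableSpace α] [MeasurableSpace β]

/-- **A disintegration kernel is pinned at atoms**: `κ(a)(B) · ν{a} = ρ({a} × B)` whenever `ν ⊗ₘ κ = ρ`. [folklore] -/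
theorem kernel_apply_mul_singleton [MeasurableSingletonClass α] {ν : Measure α} [SFinite ν] {κ : Kernel α β}
    [IsSFiniteKernel κ] {ρ : Measure (α × β)} (hdis : ν ⊗ₘ κ = ρ) (a : α) {B : Set β} (hB : MeasurableSet B) :
    κ a B * ν {a} = ρ ({a} ×ˢ B) := by
  rw [← hdis, Measure.compProd_apply_prod (measurableSet_singleton a) hB, lintegral_singleton]

/-- A function that is constant off a finite set is measurable (singletons measurable). [folklore] -/
theorem measurable_of_eq_off_finset [MeasurableSingletonClass α] {g : α → β} (C : Finset α) {b₀ : β}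
    (hg : ∀ a ∉ C, g a = b₀) : Measurable g := by
  intro S _
  have h1 : MeasurableSet (g ⁻¹' S ∩ ↑C) := ((C.finite_toSet).subset inter_subset_right).measurableSet
  have h2 : MeasurableSet (g ⁻¹' S ∩ (↑C)ᶜ) := by
    by_cases h0 : b₀ ∈ S
    · have : g ⁻¹' S ∩ (↑C : Set α)ᶜ = (↑C)ᶜ :=
        inter_eq_right.2 fun a ha => show g a ∈ S by rw [hg a ha]; exact h0
      rw [this]; exact C.measurableSet.compl
    · have : g ⁻¹' S ∩ (↑C : Set α)ᶜ = ∅ :=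
        eq_empty_of_forall_notMem fun a ha => h0 (by rw [← hg a ha.2]; exact ha.1)
      rw [this]; exact MeasurableSet.empty
  rw [← inter_union_compl (g ⁻¹' S) ↑C]
  exact h1.union h2

/-- Set integral against a finitely supported measure: a finite sum over the support. [folklore] -/
theorem setLIntegral_eq_sum_of_support [MeasurableSingletonClass α] {ν : Measure α} {C : Finset α}
    (hC : ν (↑C)ᶜ = 0) {S : Set α} (hS : MeasurableSet S) (f : α → ℝ≥0∞) :
    ∫⁻ a in S, f a ∂ν = ∑ a ∈ C, S.indicator f a * ν {a} := by
  have hae : ∀ᵐ a ∂ν, a ∈ (↑C : Set α) := mem_ae_iff.2 hC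
  rw [← lintegral_indicator hS]
  conv_lhs => rw [← Measure.restrict_eq_self_of_ae_mem hae]
  rw [lintegral_finset]

/-- A finitely supported measure on a product, evaluated on a rectangle: a finite sum over the atoms of the first
coordinate. [folklore] -/
theorem measure_prod_eq_sum_of_fst_support [MeasurableSingletonClass α] (ρ : Measure (α × β)) {C : Finset α}
    (hC : ρ.fst (↑C)ᶜ = 0) {S : Set α} (hS : MeasurableSet S) {B : Set β} (hB : MeasurableSet B) :
    ρ (S ×ˢ B) = ∑ a ∈ C, S.indicator (fun a => ρ ({a} ×ˢ B)) a := by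
  have hnull : ρ ((S ×ˢ B) \ ((↑C : Set α) ×ˢ univ)) = 0 := by
    refine measure_mono_null (fun p hp => ?_) (show ρ (Prod.fst ⁻¹' (↑C : Set α)ᶜ) = 0 by
      rw [← Measure.fst_apply C.measurableSet.compl]; exact hC)
    exact fun h => hp.2 ⟨h, mem_univ _⟩
  have h1 : ρ (S ×ˢ B) = ρ ((S ∩ ↑C) ×ˢ B) := by
    rw [← measure_inter_add_sdiff (S ×ˢ B) (C.measurableSet.prod MeasurableSet.univ), hnull, add_zero,
      Set.prod_inter_prod, Set.inter_univ]
  have hU : (S ∩ ↑C) ×ˢ B = ⋃ a ∈ C, (({a} ∩ S) : Set α) ×ˢ B := by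
    ext p
    simp only [mem_prod, mem_inter_iff, Finset.mem_coe, mem_iUnion, mem_singleton_iff, exists_prop]
    constructor
    · rintro ⟨⟨h1, h2⟩, h3⟩; exact ⟨p.1, h2, ⟨rfl, h1⟩, h3⟩
    · rintro ⟨a, h2, ⟨rfl, h1⟩, h3⟩; exact ⟨⟨h1, h2⟩, h3⟩
  rw [h1, hU, measure_biUnion_finset]
  · refine Finset.sum_congr rfl fun a _ => ?_
    by_cases ha : a ∈ S
    · rw [indicator_of_mem ha, inter_eq_left.2 (singleton_subset_iff.2 ha)]
    · rw [indicator_of_notMem ha, show ({a} ∩ S : Set α) = ∅ from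
        eq_empty_of_forall_notMem fun z hz => ha (mem_singleton_iff.1 hz.1 ▸ hz.2), Set.empty_prod, measure_empty]
  · intro a _ b _ hab
    exact Set.disjoint_prod.2 (Or.inl (Disjoint.mono inter_subset_left inter_subset_left (disjoint_singleton.2 hab)))
  · intro a _
    exact ((measurableSet_singleton a).inter hS).prod hB

end Generic

/-! ### The atom condition -/

section Atom

variable {d : ℕ}

/-- `ρ({a} × [0,1]) = ν{a}`. [folklore] -/
theorem map_initLast_singleton_prod_univ (μ : Measure (Fin (d + 1) → I)) (a : Fin d → I) :
    μ.map initLast ({a} ×ˢ (univ : Set I)) = (μ.map initLast).fst {a} := by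
  rw [Measure.fst_apply (measurableSet_singleton a), prod_univ]

/-- **Classical CIS, atom form, for the last coordinate** of a law on `Q_{d+1}`: for all conditioning points
`a ≤ b` and all `x`, `ρ({b} × [0,x]) · ν{a} ≤ ρ({a} × [0,x]) · ν{b}` (`ρ` = law of `(x', x_d)`, `ν = ρ.fst`) — i.e.
`P(X_d ≤ x | X' = b) ≤ P(X_d ≤ x | X' = a)` whenever `a, b` are atoms; void otherwise. [this work] -/
def CondIncrAtom (μ : Measure (Fin (d + 1) → I)) : Prop :=
  ∀ ⦃a b : Fin d → I⦄, a ≤ b → ∀ x : I,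
    μ.map initLast ({b} ×ˢ Iic x) * (μ.map initLast).fst {a} ≤ μ.map initLast ({a} ×ˢ Iic x) * (μ.map initLast).fst {b}

/-- **Classical CIS, atom form, at every level.** [this work] -/
def IsCISatom : (d : ℕ) → Measure (Fin d → I) → Prop
  | 0, _ => True
  | d + 1, μ => IsCISatom d (μ.map initLast).fst ∧ CondIncrAtom μ

/-- **`IsCISae` implies the atom condition** (every finite law): a disintegration kernel is pinned at the atoms, and
a pair of atoms of positive mass is an atom of `ν ⊗ ν`. [this work] -/
theorem condIncrAtom_of_aepairMonoKernel (μ : Measure (Fin (d + 1) → I)) [IsFiniteMeasure μ]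
    (κ : Kernel (Fin d → I) I) [IsMarkovKernel κ] (hdis : (μ.map initLast).fst ⊗ₘ κ = μ.map initLast)
    (hmono : AEPairMonoKernel (μ.map initLast).fst κ) : CondIncrAtom μ := by
  intro a b hab x
  by_cases ha : (μ.map initLast).fst {a} = 0
  · rw [ha, mul_zero]; exact bot_le
  by_cases hb : (μ.map initLast).fst {b} = 0
  · have h0 : μ.map initLast ({b} ×ˢ Iic x) = 0 :=
      measure_mono_null (Set.prod_mono_right (subset_univ _)) (by rw [map_initLast_singleton_prod_univ]; exact hb)
    rw [h0, zero_mul]; exact bot_le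
  have hatom : ((μ.map initLast).fst.prod (μ.map initLast).fst) {(a, b)} ≠ 0 := by
    rw [← singleton_prod_singleton, Measure.prod_prod]; exact mul_ne_zero ha hb
  have hle : κ b (Iic x) ≤ κ a (Iic x) := of_ae_of_measure_singleton_ne_zero hmono hatom hab x
  calc μ.map initLast ({b} ×ˢ Iic x) * (μ.map initLast).fst {a}
      = κ b (Iic x) * (μ.map initLast).fst {b} * (μ.map initLast).fst {a} := by
        rw [kernel_apply_mul_singleton hdis b measurableSet_Iic]
    _ ≤ κ a (Iic x) * (μ.map initLast).fst {b} * (μ.map initLast).fst {a} := by gcongr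
    _ = κ a (Iic x) * (μ.map initLast).fst {a} * (μ.map initLast).fst {b} := by ring
    _ = μ.map initLast ({a} ×ˢ Iic x) * (μ.map initLast).fst {b} := by
        rw [kernel_apply_mul_singleton hdis a measurableSet_Iic]

/-- **`IsCISae d μ → IsCISatom d μ`** for every finite measure. [this work] -/
theorem IsCISae.isCISatom : ∀ (d : ℕ) (μ : Measure (Fin d → I)) [IsFiniteMeasure μ], IsCISae d μ → IsCISatom d μ := by
  intro d
  induction d with
  | zero => intro μ _ _; trivial
  | succ d ih =>
    intro μ _ hμ
    obtain ⟨h1, κ, hκ, hdis, hmono⟩ := hμ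
    exact ⟨ih _ h1, condIncrAtom_of_aepairMonoKernel μ κ hdis hmono⟩

end Atom

/-! ### The atomic kernel of a finitely supported conditioning law -/

section Kernel

variable {d : ℕ} (μ : Measure (Fin (d + 1) → I))

/-- The (unnormalised) conditional measure of the last coordinate at the conditioning point `a`:
`B ↦ ρ({a} × B)`. [this work] -/
def sliceMeasure (a : Fin d → I) : Measure I := ((μ.map initLast).restrict ({a} ×ˢ univ)).snd

/-- `sliceMeasure μ a B = ρ({a} × B)`. [this work] -/
theorem sliceMeasure_apply (a : Fin d → I) {B : Set I} (hB : MeasurableSet B) :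
    sliceMeasure μ a B = μ.map initLast ({a} ×ˢ B) := by
  rw [sliceMeasure, Measure.snd_apply hB, Measure.restrict_apply (measurable_snd hB)]
  congr 1
  ext p
  simp only [mem_inter_iff, mem_preimage, mem_prod, mem_univ, and_true, mem_singleton_iff]
  tauto

/-- The conditional law at `a` (normalised slice) when `a` is an atom, `δ_0` otherwise. [this work] -/
def atomKernelFun (a : Fin d → I) : Measure I :=
  if (μ.map initLast).fst {a} = 0 then Measure.dirac ⊥ else ((μ.map initLast).fst {a})⁻¹ • sliceMeasure μ a

/-- Off the (finite) support the kernel function is `δ_0`. [this work] -/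
theorem atomKernelFun_of_notMem {C : Finset (Fin d → I)} (hC : (μ.map initLast).fst (↑C)ᶜ = 0)
    {a : Fin d → I} (ha : a ∉ C) : atomKernelFun μ a = Measure.dirac ⊥ := by
  have h0 : (μ.map initLast).fst {a} = 0 := measure_mono_null (fun z hz => by
    rw [mem_singleton_iff.1 hz]; exact ha) hC
  simp [atomKernelFun, h0]

/-- **The atomic kernel**: conditional laws at the atoms of a finitely supported conditioning law, `δ_0`
elsewhere. [this work] -/
def atomKernel {C : Finset (Fin d → I)} (hC : (μ.map initLast).fst (↑C)ᶜ = 0) : Kernel (Fin d → I) I where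
  toFun := atomKernelFun μ
  measurable' := measurable_of_eq_off_finset C fun _ ha => atomKernelFun_of_notMem μ hC ha

/-- Values of the atomic kernel. [this work] -/
theorem atomKernel_apply {C : Finset (Fin d → I)} (hC : (μ.map initLast).fst (↑C)ᶜ = 0) (a : Fin d → I) :
    atomKernel μ hC a = atomKernelFun μ a := rfl

/-- At an atom the kernel is the normalised slice: `κ(a)(B) = ρ({a} × B) / ν{a}`. [this work] -/
theorem atomKernel_apply_of_ne_zero {C : Finset (Fin d → I)} (hC : (μ.map initLast).fst (↑C)ᶜ = 0)
    {a : Fin d → I} (ha : (μ.map initLast).fst {a} ≠ 0) {B : Set I} (hB : MeasurableSet B) :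
    atomKernel μ hC a B = ((μ.map initLast).fst {a})⁻¹ * μ.map initLast ({a} ×ˢ B) := by
  rw [atomKernel_apply, atomKernelFun, if_neg ha, Measure.smul_apply, sliceMeasure_apply μ a hB, smul_eq_mul]

/-- At every point, `κ(a)(B) · ν{a} = ρ({a} × B)`. [this work] -/
theorem atomKernel_apply_mul [IsFiniteMeasure μ] {C : Finset (Fin d → I)} (hC : (μ.map initLast).fst (↑C)ᶜ = 0)
    (a : Fin d → I) {B : Set I} (hB : MeasurableSet B) :
    atomKernel μ hC a B * (μ.map initLast).fst {a} = μ.map initLast ({a} ×ˢ B) := by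
  by_cases ha : (μ.map initLast).fst {a} = 0
  · rw [ha, mul_zero]
    symm
    exact measure_mono_null (Set.prod_mono_right (subset_univ B)) (by rw [map_initLast_singleton_prod_univ]; exact ha)
  · rw [atomKernel_apply_of_ne_zero μ hC ha hB, mul_comm, ← mul_assoc,
      ENNReal.mul_inv_cancel ha (measure_ne_top _ _), one_mul]

/-- The atomic kernel is Markov. [this work] -/
instance isMarkovKernel_atomKernel [IsFiniteMeasure μ] {C : Finset (Fin d → I)}
    (hC : (μ.map initLast).fst (↑C)ᶜ = 0) : IsMarkovKernel (atomKernel μ hC) := by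
  refine ⟨fun a => ⟨?_⟩⟩
  by_cases ha : (μ.map initLast).fst {a} = 0
  · rw [atomKernel_apply, atomKernelFun, if_pos ha, measure_univ]
  · rw [atomKernel_apply_of_ne_zero μ hC ha MeasurableSet.univ, map_initLast_singleton_prod_univ,
      ENNReal.inv_mul_cancel ha (measure_ne_top _ _)]

/-- **The atomic kernel disintegrates the law**: `ν ⊗ₘ κ = ρ` (checked on rectangles). [this work] -/
theorem fst_compProd_atomKernel [IsFiniteMeasure μ] {C : Finset (Fin d → I)}
    (hC : (μ.map initLast).fst (↑C)ᶜ = 0) :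
    (μ.map initLast).fst ⊗ₘ atomKernel μ hC = μ.map initLast := by
  haveI : IsFiniteMeasure (μ.map initLast) := Measure.isFiniteMeasure_map μ _
  refine ext_of_generate_finite _ generateFrom_prod.symm isPiSystem_prod (fun s hs => ?_) ?_
  · obtain ⟨S, hS, B, hB, rfl⟩ := hs
    have hS' : MeasurableSet S := hS
    have hB' : MeasurableSet B := hB
    rw [Measure.compProd_apply_prod hS' hB', setLIntegral_eq_sum_of_support hC hS',
      measure_prod_eq_sum_of_fst_support (μ.map initLast) hC hS' hB']
    refine Finset.sum_congr rfl fun a _ => ?_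
    by_cases ha : a ∈ S
    · rw [indicator_of_mem ha, indicator_of_mem ha, atomKernel_apply_mul μ hC a hB']
    · rw [indicator_of_notMem ha, indicator_of_notMem ha, zero_mul]
  · rw [Measure.compProd_apply_univ, Measure.fst_univ]

/-- For a finitely supported `ν`, almost every point is an atom. [folklore] -/
theorem ae_measure_singleton_ne_zero {α : Type*} [MeasurableSpace α] [MeasurableSingletonClass α] (ν : Measure α)
    {C : Finset α} (hC : ν (↑C)ᶜ = 0) : ∀ᵐ a ∂ν, ν {a} ≠ 0 := by
  rw [ae_iff]
  have hT : ν ((↑C : Set α) ∩ {a | ν {a} = 0}) = 0 := by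
    rw [← Set.biUnion_of_singleton ((↑C : Set α) ∩ {a | ν {a} = 0}),
      measure_biUnion_null_iff ((C.finite_toSet.inter_of_left _).countable)]
    exact fun a ha => ha.2
  refine measure_mono_null (fun a ha => ?_) (measure_union_null hT hC)
  have ha' : ν {a} = 0 := by simpa using ha
  by_cases haC : a ∈ C
  · exact Or.inl ⟨Finset.mem_coe.2 haC, ha'⟩
  · exact Or.inr haC

/-- **The atomic kernel is stochastically increasing on almost every pair** under the atom condition. [this work] -/
theorem aepairMonoKernel_atomKernel [IsFiniteMeasure μ] {C : Finset (Fin d → I)}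
    (hC : (μ.map initLast).fst (↑C)ᶜ = 0) (hA : CondIncrAtom μ) :
    AEPairMonoKernel (μ.map initLast).fst (atomKernel μ hC) := by
  have hpos : ∀ᵐ a ∂(μ.map initLast).fst, a ∈ {a | (μ.map initLast).fst {a} ≠ 0} :=
    ae_measure_singleton_ne_zero _ hC
  filter_upwards [ae_prod_fst_mem (ν := (μ.map initLast).fst) hpos,
    ae_prod_snd_mem (μ := (μ.map initLast).fst) hpos] with p h1 h2 hle x
  have hna : (μ.map initLast).fst {p.1} ≠ 0 := h1
  have hnb : (μ.map initLast).fst {p.2} ≠ 0 := h2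
  have hnat : (μ.map initLast).fst {p.1} ≠ ⊤ := measure_ne_top _ _
  have hnbt : (μ.map initLast).fst {p.2} ≠ ⊤ := measure_ne_top _ _
  rw [atomKernel_apply_of_ne_zero μ hC hnb measurableSet_Iic, atomKernel_apply_of_ne_zero μ hC hna measurableSet_Iic,
    ← ENNReal.mul_le_mul_iff_right hna hnat, ← ENNReal.mul_le_mul_iff_right hnb hnbt]
  have key := hA hle x
  have e1 : (μ.map initLast).fst {p.2} * ((μ.map initLast).fst {p.1} *
      (((μ.map initLast).fst {p.2})⁻¹ * μ.map initLast ({p.2} ×ˢ Iic x))) =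
      μ.map initLast ({p.2} ×ˢ Iic x) * (μ.map initLast).fst {p.1} := by
    rw [← mul_assoc, mul_comm ((μ.map initLast).fst {p.2}), mul_assoc, ← mul_assoc ((μ.map initLast).fst {p.2}),
      ENNReal.mul_inv_cancel hnb hnbt, one_mul, mul_comm]
  have e2 : (μ.map initLast).fst {p.2} * ((μ.map initLast).fst {p.1} *
      (((μ.map initLast).fst {p.1})⁻¹ * μ.map initLast ({p.1} ×ˢ Iic x))) =
      μ.map initLast ({p.1} ×ˢ Iic x) * (μ.map initLast).fst {p.2} := by
    rw [← mul_assoc ((μ.map initLast).fst {p.1}), ENNReal.mul_inv_cancel hna hnat, one_mul, mul_comm]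
  rw [e1, e2]
  exact key

/-- **Atom condition + finite support of the conditioning law ⇒ one more level of `IsCISae`.** [this work] -/
theorem isCISae_succ_of_condIncrAtom [IsProbabilityMeasure μ] (h1 : IsCISae d (μ.map initLast).fst)
    {C : Finset (Fin d → I)} (hC : (μ.map initLast).fst (↑C)ᶜ = 0) (hA : CondIncrAtom μ) : IsCISae (d + 1) μ :=
  ⟨h1, atomKernel μ hC, inferInstance, fst_compProd_atomKernel μ hC, aepairMonoKernel_atomKernel μ hC hA⟩

/-- A finitely supported law has a finitely supported conditioning marginal. [folklore] -/
theorem exists_fst_support {D : Finset (Fin (d + 1) → I)} (hD : μ (↑D)ᶜ = 0) :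
    ∃ C : Finset (Fin d → I), (μ.map initLast).fst (↑C)ᶜ = 0 := by
  classical
  refine ⟨D.image fun z => (initLast z).1, ?_⟩
  rw [Measure.fst_apply (Finset.measurableSet _).compl,
    Measure.map_apply measurable_initLast (measurable_fst (Finset.measurableSet _).compl)]
  have hsub : (↑D : Set (Fin (d + 1) → I)) ⊆
      initLast ⁻¹' (Prod.fst ⁻¹' (↑(D.image fun z => (initLast z).1) : Set (Fin d → I))) := fun z hz =>
    Finset.mem_coe.2 (Finset.mem_image_of_mem _ (Finset.mem_coe.1 hz))
  exact measure_mono_null (compl_subset_compl.2 hsub) hD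

end Kernel

/-! ### The equivalence and its consequences -/

section Equivalence

variable {d : ℕ}

/-- **For finitely supported laws, the classical atom condition at every level gives CIS in the a.e.-kernel sense.**
[this work] -/
theorem isCISae_of_isCISatom_of_finite_support :
    ∀ (d : ℕ) (μ : Measure (Fin d → I)) [IsProbabilityMeasure μ],
      (∃ D : Finset (Fin d → I), μ (↑D)ᶜ = 0) → IsCISatom d μ → IsCISae d μ := by
  intro d
  induction d with
  | zero => intro μ _ _ _; trivial
  | succ d ih =>
    rintro μ _ ⟨D, hD⟩ ⟨hat, hA⟩
    obtain ⟨C, hC⟩ := exists_fst_support μ hD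
    exact isCISae_succ_of_condIncrAtom μ (ih _ ⟨C, hC⟩ hat) hC hA

/-- **On finitely supported laws, the a.e.-kernel notion IS classical CIS** (atom form). [this work] -/
theorem isCISae_iff_isCISatom_of_finite_support (μ : Measure (Fin d → I)) [IsProbabilityMeasure μ]
    (hD : ∃ D : Finset (Fin d → I), μ (↑D)ᶜ = 0) : IsCISae d μ ↔ IsCISatom d μ :=
  ⟨IsCISae.isCISatom d μ, isCISae_of_isCISatom_of_finite_support d μ hD⟩

/-- **Every finitely supported classically-CIS law on `[0,1]³` satisfies Sahi's `E₃ ≥ 0`** for nonnegative measurable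
increasing triples (unconditional; e.g. any CIS law on a finite grid `{0,…,m}³`). [this work] -/
theorem msahiE_three_nonneg_of_isCISatom (μ : Measure (Fin 3 → I)) [IsProbabilityMeasure μ]
    (hD : ∃ D : Finset (Fin 3 → I), μ (↑D)ᶜ = 0) (hμ : IsCISatom 3 μ) (f : Fin 3 → (Fin 3 → I) → ℝ)
    (hfm : ∀ i, Measurable (f i)) (hf0 : ∀ i x, 0 ≤ f i x) (hmono : ∀ i, Monotone (f i)) : 0 ≤ msahiE μ 3 f :=
  (isCISae_of_isCISatom_of_finite_support 3 μ hD hμ).msahiE_three_nonneg μ f hfm hf0 hmono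

/-- Finitely supported classically-CIS laws on `Q_d` are Sahi-positive of order `n` given `L(d,n)`. [this work] -/
theorem msahiE_nonneg_of_isCISatom {n : ℕ} (hL : LiebSahiContinuum d n) (μ : Measure (Fin d → I))
    [IsProbabilityMeasure μ] (hD : ∃ D : Finset (Fin d → I), μ (↑D)ᶜ = 0) (hμ : IsCISatom d μ)
    (f : Fin n → (Fin d → I) → ℝ) (hfm : ∀ i, Measurable (f i)) (hf0 : ∀ i x, 0 ≤ f i x)
    (hmono : ∀ i, Monotone (f i)) : 0 ≤ msahiE μ n f :=
  (isCISae_of_isCISatom_of_finite_support d μ hD hμ).msahiE_nonneg hL μ f hfm hf0 hmono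

/-- Finitely supported classically-CIS laws on `Q_d` are positively associated (Müller–Stoyan Thm. 3.10.11).
[this work] -/
theorem isPositivelyAssociated_of_isCISatom (μ : Measure (Fin d → I)) [IsProbabilityMeasure μ]
    (hD : ∃ D : Finset (Fin d → I), μ (↑D)ᶜ = 0) (hμ : IsCISatom d μ) :
    Literature.Probability.Percolation.IsPositivelyAssociated μ :=
  (isCISae_of_isCISatom_of_finite_support d μ hD hμ).isPositivelyAssociated μ

end Equivalence

end Summit.CriticalPhenomena.PercolationContinuityZ3.Theorems.SahiCIS

end
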